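import Summits.MatrixMultiplication.MatrixMultiplication.Theorems.FidelityWitnessesLinearDefectLawFidelity
import Summits.MatrixMultiplication.MatrixMultiplication.Theorems.LinearDefectLaw.Negative.TwoByTwoRungs
import Literature.Computability.AlgebraicComplexity.BorderRankMatMulTwoHolds
import Literature.Computability.AlgebraicComplexity.AlderStrassen
import Summits.MatrixMultiplication.MatrixMultiplication.Theorems.FidelityWitnessesLinearDefectLawStubOneStepGain
import Summits.MatrixMultiplication.MatrixMultiplication.Theorems.FidelityWitnessesLinearDefectLawStubFreeUnitProduct
import Summits.MatrixMultiplication.MatrixMultiplication.Theorems.FidelityWitnessesLinearDefectLawStubFreeUnitProductDet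

/-!
# `FidelityWitnesses.LinearDefectLaw` (stmt-MatrixMultiplication-14039), line `border-singular-values` — II: the unit slope

Second reduction file (imports `…LinearDefectLawFidelity`). Kernel-checked passage from the line's stubs to `UnitSlope`:
* `slope_small` — below the window (`n ≥ 2`, `r ≤ 2n − 1`): ONE-STEP GAIN (landed `OneStepGain.stub_oneStepGain`, p84997) + FREE UNIT
  PRODUCT (landed `FreeUnitProductDet.stub_freeUnitProductDet`, p89630; `FreeUnitProduct.stub_freeUnitProduct`, `r ≤ 2n − 2`, p84979)
  give the unit slope for every `S`, no optimality;
* `slope_window` — on the window `2n ≤ r < R̲`: one-step gain + a SPECTRAL RESIDUAL hypothesis at δ-optimal tensors, via a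
  `sup`-bookkeeping over δ-optimal rank-`≤ r` tensors (`M_r := sSup fid ≤ c − 1`);
* `unitSlope_of_stubs` — both regimes, with `n ≤ 1` degenerate (`R̲(⟨n,n,n⟩) ≤ n³ ≤ 1` forces `r = 0`, `S = 0`);
* `linearDefectLaw_of_stubs` — explicit-hypothesis composition to the crux BODY;
* `slope_below_window` — UNCONDITIONAL theorem family: `M(n, r+1) ≥ M(n, r) + 1` for all `n ≥ 2`, `r ≤ 2n − 1`;
* `unitSlope_not_strengthened` — the unit cannot be raised (landed `(2,6)` tightness); `sevenEighths_of_window_two_six` /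
  `sixEighths_of_window_two_five` — the first two window instances are exactly the route's `n = 2` rungs (explicit-hypothesis form).
File III (`…OfCore`) supplies the spectral residual hypothesis from the line's open `Core`.
-/

noncomputable section

namespace Summit.MatrixMultiplication.MatrixMultiplication.Theorems.LinearDefectLaw.Reduction

open scoped BigOperators ComplexConjugate
open Literature.Computability.AlgebraicComplexity
open Summit.MatrixMultiplication.MatrixMultiplication.Theses.FidelityWitnesses (LinearDefectLaw)
open Summit.MatrixMultiplication.MatrixMultiplication.Theorems

set_option linter.dupNamespace false

/-! ## The landed stubs in the line's vocabulary (definitional unfoldings of their raw statements) -/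

/-- S1 in vocabulary form (`fid`, `resid`, `triEval`, `IsUnitVec` unfold definitionally to the registered raw
signature of `stub_oneStepGain`). -/
theorem oneStepGain :
    ∀ (n r : ℕ) (S : P n → P n → P n → ℂ) (x y z : P n → ℂ), tensorRank S ≤ r → S ≠ 0 →
      IsUnitVec x → IsUnitVec y → IsUnitVec z →
      ∃ S' : P n → P n → P n → ℂ, tensorRank S' ≤ r + 1 ∧
        fid S + ‖triEval (resid S) x y z‖ ^ 2 ≤ fid S' :=
  Summit.MatrixMultiplication.MatrixMultiplication.Theorems.LinearDefectLaw.OneStepGain.stub_oneStepGain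

/-- S2 in vocabulary form. -/
theorem freeUnitProduct :
    ∀ (n r : ℕ) (S : P n → P n → P n → ℂ), r + 2 ≤ 2 * n → tensorRank S ≤ r →
      ∃ x y z : P n → ℂ, IsUnitVec x ∧ IsUnitVec y ∧ IsUnitVec z ∧
        triEval S x y z = 0 ∧ triEval (matMulTensor ℂ n n n) x y z = 1 :=
  Summit.MatrixMultiplication.MatrixMultiplication.Theorems.LinearDefectLaw.FreeUnitProduct.stub_freeUnitProduct

/-- S2⁺ in vocabulary form (reshape r2: free regime `r ≤ 2n − 1`, `n ≥ 2`). -/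
theorem freeUnitProductDet :
    ∀ (n r : ℕ) (S : P n → P n → P n → ℂ), 2 ≤ n → r + 1 ≤ 2 * n → tensorRank S ≤ r →
      ∃ x y z : P n → ℂ, IsUnitVec x ∧ IsUnitVec y ∧ IsUnitVec z ∧
        triEval S x y z = 0 ∧ triEval (matMulTensor ℂ n n n) x y z = 1 :=
  Summit.MatrixMultiplication.MatrixMultiplication.Theorems.LinearDefectLaw.FreeUnitProductDet.stub_freeUnitProductDet

/-- `UnitSlope` at one level `(n, r)`. -/
def SlopeAt (n r : ℕ) : Prop :=
  ∀ c : ℝ, (∀ S' : P n → P n → P n → ℂ, tensorRank S' ≤ r + 1 → ‖overlap S'‖ ^ 2 ≤ c * normSq S') →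
    ∀ S : P n → P n → P n → ℂ, tensorRank S ≤ r → ‖overlap S‖ ^ 2 ≤ (c - 1) * normSq S

/-- **Below the window** (`r ≤ 2n − 2`): S1 + S2 give the unit slope at level `r` for every `S`, no optimality. -/
theorem slope_small
    (h1 : ∀ (n r : ℕ) (S : P n → P n → P n → ℂ) (x y z : P n → ℂ), tensorRank S ≤ r → S ≠ 0 →
      IsUnitVec x → IsUnitVec y → IsUnitVec z →
      ∃ S' : P n → P n → P n → ℂ, tensorRank S' ≤ r + 1 ∧
        fid S + ‖triEval (resid S) x y z‖ ^ 2 ≤ fid S')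
    (h2 : ∀ (n r : ℕ) (S : P n → P n → P n → ℂ), 2 ≤ n → r + 1 ≤ 2 * n → tensorRank S ≤ r →
      ∃ x y z : P n → ℂ, IsUnitVec x ∧ IsUnitVec y ∧ IsUnitVec z ∧
        triEval S x y z = 0 ∧ triEval (matMulTensor ℂ n n n) x y z = 1)
    (n r : ℕ) (hn : 2 ≤ n) (hr : r + 1 ≤ 2 * n) : SlopeAt n r := by
  intro c hc S hS
  by_cases hS0 : S = 0
  · subst hS0
    rw [overlap_zero, normSq_zero]
    simp
  obtain ⟨x, y, z, hx, hy, hz, hSxyz, hTxyz⟩ := h2 n r S hn hr hS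
  obtain ⟨S', hS'r, hgain⟩ := h1 n r S x y z hS hS0 hx hy hz
  rw [triEval_resid, hSxyz, hTxyz] at hgain
  simp only [mul_zero, sub_zero, norm_one, one_pow] at hgain
  have hfid : fid S ≤ c - 1 := fid_le_of_gain hc hS'r one_pos hgain
  have hns : 0 < normSq S := normSq_pos_of_ne_zero hS0
  unfold fid at hfid
  rwa [div_le_iff₀ hns] at hfid

/-- **On the window** (`2n − 1 ≤ r < R̲`): S1 + S3 give the unit slope at level `r` — the `sup`-bookkeeping over
`δ`-optimal tensors (`M_r := sup {fid S : rank S ≤ r} ≤ c − 1`). -/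
theorem slope_window
    (h1 : ∀ (n r : ℕ) (S : P n → P n → P n → ℂ) (x y z : P n → ℂ), tensorRank S ≤ r → S ≠ 0 →
      IsUnitVec x → IsUnitVec y → IsUnitVec z →
      ∃ S' : P n → P n → P n → ℂ, tensorRank S' ≤ r + 1 ∧
        fid S + ‖triEval (resid S) x y z‖ ^ 2 ≤ fid S')
    (h3 : ∀ (n r : ℕ), 2 * n ≤ r → r < algBorderRank (matMulTensor ℂ n n n) →
      ∀ ε : ℝ, 0 < ε → ∃ δ : ℝ, 0 < δ ∧
        ∀ S : P n → P n → P n → ℂ, tensorRank S ≤ r → S ≠ 0 →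
          (∀ S' : P n → P n → P n → ℂ, tensorRank S' ≤ r → fid S' ≤ fid S + δ) →
          ∃ x y z : P n → ℂ, IsUnitVec x ∧ IsUnitVec y ∧ IsUnitVec z ∧
            1 - ε ≤ ‖triEval (resid S) x y z‖ ^ 2)
    (n r : ℕ) (hw : 2 * n ≤ r) (hb : r < algBorderRank (matMulTensor ℂ n n n)) : SlopeAt n r := by
  intro c hc S hS
  by_cases hS0 : S = 0
  · subst hS0
    rw [overlap_zero, normSq_zero]
    simp
  -- the format is nonempty, so the unit product certifies `c ≥ 1`
  have hn : 0 < n := pos_of_ne_zero hS0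
  obtain ⟨S₀, hS₀r, hS₀o, hS₀n⟩ := exists_unitProduct hn
  have hc1 : 1 ≤ c := by
    have h := hc S₀ (hS₀r.trans (by omega))
    rw [hS₀o, hS₀n] at h
    simpa using h
  -- `M_r = sSup F`, `F` the fidelities of rank-`≤ r` tensors
  set F : Set ℝ := fid '' {S' : P n → P n → P n → ℂ | tensorRank S' ≤ r} with hF
  have hFne : F.Nonempty := ⟨fid S, S, hS, rfl⟩
  have hFbdd : BddAbove F := by
    refine ⟨(n : ℝ) ^ 3, fun f hf => ?_⟩
    obtain ⟨S', -, rfl⟩ := hf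
    exact fid_le_cube S'
  have hM : ∀ S' : P n → P n → P n → ℂ, tensorRank S' ≤ r → fid S' ≤ sSup F :=
    fun S' h => le_csSup hFbdd ⟨S', h, rfl⟩
  -- main claim: `M_r ≤ c − 1`
  have hmain : sSup F ≤ c - 1 := by
    apply le_of_forall_pos_le_add
    intro η hη
    obtain ⟨δ, hδ, hSR⟩ := h3 n r hw hb (min (η / 2) (1 / 2)) (lt_min (by linarith) (by norm_num))
    have hε1 : min (η / 2) (1 / 2) ≤ η / 2 := min_le_left _ _
    have hε2 : min (η / 2) (1 / 2) ≤ 1 / 2 := min_le_right _ _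
    have hδ' : 0 < min δ (η / 2) := lt_min hδ (by linarith)
    have hδ1 : min δ (η / 2) ≤ δ := min_le_left _ _
    have hδ2 : min δ (η / 2) ≤ η / 2 := min_le_right _ _
    obtain ⟨f, hf, hlt⟩ := exists_lt_of_lt_csSup hFne (show sSup F - min δ (η / 2) < sSup F by linarith)
    obtain ⟨S₁, hS₁, rfl⟩ := hf
    by_cases hS₁0 : S₁ = 0
    · subst hS₁0
      rw [fid_zero] at hlt
      linarith
    · have hopt : ∀ S' : P n → P n → P n → ℂ, tensorRank S' ≤ r → fid S' ≤ fid S₁ + δ :=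
        fun S' h => (hM S' h).trans (by linarith)
      obtain ⟨x, y, z, hx, hy, hz, hge⟩ := hSR S₁ hS₁ hS₁0 hopt
      obtain ⟨S', hS'r, hgain⟩ := h1 n r S₁ x y z hS₁ hS₁0 hx hy hz
      have hg : 0 < 1 - min (η / 2) (1 / 2) := by linarith
      have hfid : fid S₁ ≤ c - (1 - min (η / 2) (1 / 2)) :=
        fid_le_of_gain hc hS'r hg (le_trans (by linarith) hgain)
      linarith
  -- conclude for the given `S`
  have hfS : fid S ≤ c - 1 := (hM S hS).trans hmain
  have hns : 0 < normSq S := normSq_pos_of_ne_zero hS0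
  unfold fid at hfS
  rwa [div_le_iff₀ hns] at hfS

/-- **`UnitSlope` from the three stubs** (regime split at `r = 2n − 2`). -/
theorem unitSlope_of_stubs
    (h1 : ∀ (n r : ℕ) (S : P n → P n → P n → ℂ) (x y z : P n → ℂ), tensorRank S ≤ r → S ≠ 0 →
      IsUnitVec x → IsUnitVec y → IsUnitVec z →
      ∃ S' : P n → P n → P n → ℂ, tensorRank S' ≤ r + 1 ∧
        fid S + ‖triEval (resid S) x y z‖ ^ 2 ≤ fid S')
    (h2 : ∀ (n r : ℕ) (S : P n → P n → P n → ℂ), 2 ≤ n → r + 1 ≤ 2 * n → tensorRank S ≤ r →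
      ∃ x y z : P n → ℂ, IsUnitVec x ∧ IsUnitVec y ∧ IsUnitVec z ∧
        triEval S x y z = 0 ∧ triEval (matMulTensor ℂ n n n) x y z = 1)
    (h3 : ∀ (n r : ℕ), 2 * n ≤ r → r < algBorderRank (matMulTensor ℂ n n n) →
      ∀ ε : ℝ, 0 < ε → ∃ δ : ℝ, 0 < δ ∧
        ∀ S : P n → P n → P n → ℂ, tensorRank S ≤ r → S ≠ 0 →
          (∀ S' : P n → P n → P n → ℂ, tensorRank S' ≤ r → fid S' ≤ fid S + δ) →
          ∃ x y z : P n → ℂ, IsUnitVec x ∧ IsUnitVec y ∧ IsUnitVec z ∧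
            1 - ε ≤ ‖triEval (resid S) x y z‖ ^ 2) :
    UnitSlope := by
  intro n r c hb hc S hS
  by_cases hS0 : S = 0
  · subst hS0
    rw [overlap_zero, normSq_zero]
    simp
  rcases le_or_gt 2 n with hn | hn
  · rcases Nat.lt_or_ge r (2 * n) with hsmall | hbig
    · exact slope_small h1 h2 n r hn (by omega) c hc S hS
    · exact slope_window h1 h3 n r hbig hb c hc S hS
  · -- `n ≤ 1`: `R̲(⟨n,n,n⟩) ≤ R(⟨n,n,n⟩) ≤ n³ ≤ 1`, so `r = 0` and `S = 0`
    exfalso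
    have hT : algBorderRank (matMulTensor ℂ n n n) ≤ 1 :=
      calc algBorderRank (matMulTensor ℂ n n n) ≤ tensorRank (matMulTensor ℂ n n n) :=
            algBorderRank_le_tensorRank _
        _ ≤ n * n * n := tensorRank_matMulTensor_le (K := ℂ) n n n
        _ ≤ 1 := by interval_cases n <;> norm_num
    have hr0 : r = 0 := by omega
    subst hr0
    obtain ⟨w, u, v, hSdec⟩ := exists_eq_sum_triad_of_tensorRank_le hS
    exact hS0 (by rw [hSdec]; simp)

/-! ## The composition (kernel-checked, no `sorry` of its own) -/

/-- **Pure-logic composition, explicit-hypothesis form** (conclusion = the crux's body): S1, S2, S3 ⇒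
`UnitSlope` ⇒ `LinearDefectLaw`. -/
theorem linearDefectLaw_of_stubs
    (h1 : ∀ (n r : ℕ) (S : P n → P n → P n → ℂ) (x y z : P n → ℂ), tensorRank S ≤ r → S ≠ 0 →
      IsUnitVec x → IsUnitVec y → IsUnitVec z →
      ∃ S' : P n → P n → P n → ℂ, tensorRank S' ≤ r + 1 ∧
        fid S + ‖triEval (resid S) x y z‖ ^ 2 ≤ fid S')
    (h2 : ∀ (n r : ℕ) (S : P n → P n → P n → ℂ), 2 ≤ n → r + 1 ≤ 2 * n → tensorRank S ≤ r →
      ∃ x y z : P n → ℂ, IsUnitVec x ∧ IsUnitVec y ∧ IsUnitVec z ∧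
        triEval S x y z = 0 ∧ triEval (matMulTensor ℂ n n n) x y z = 1)
    (h3 : ∀ (n r : ℕ), 2 * n ≤ r → r < algBorderRank (matMulTensor ℂ n n n) →
      ∀ ε : ℝ, 0 < ε → ∃ δ : ℝ, 0 < δ ∧
        ∀ S : P n → P n → P n → ℂ, tensorRank S ≤ r → S ≠ 0 →
          (∀ S' : P n → P n → P n → ℂ, tensorRank S' ≤ r → fid S' ≤ fid S + δ) →
          ∃ x y z : P n → ℂ, IsUnitVec x ∧ IsUnitVec y ∧ IsUnitVec z ∧
            1 - ε ≤ ‖triEval (resid S) x y z‖ ^ 2) :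
    ∀ n r : ℕ, ∀ S : Fin n × Fin n → Fin n × Fin n → Fin n × Fin n → ℂ, tensorRank S ≤ r →
      ‖∑ a, ∑ b, ∑ c, S a b c * matMulTensor ℂ n n n a b c‖ ^ 2 ≤
        ((n : ℝ) ^ 3 + (r : ℝ) - (algBorderRank (matMulTensor ℂ n n n) : ℝ)) *
          ∑ a, ∑ b, ∑ c, ‖S a b c‖ ^ 2 :=
  law_of_unitSlope (unitSlope_of_stubs h1 h2 h3)

/-! ## Consistency with the landed Negative lane (the stub constants are forced) -/

/-- **The unit in `UnitSlope` cannot be raised**: for every `η > 0` the strengthening "`c − 1 − η` bounds rank `r`"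
is FALSE — at `(n, r) = (2, 6)` (`6 < 7 = R̲(⟨2,2,2⟩)`, tree theorem `algBorderRank_matMulTensor_two`) the constant
`c = 8` bounds rank `7` (Cauchy–Schwarz) while the honest rank-6 tensor `⟨2,2,2⟩ − a₂₂⊗b₂₂⊗c₂₂` of the landed
`linearDefectLaw_tight_two_six` has ratio exactly `7 > 8 − 1 − η`. So S3 is stated at the only admissible gain
(`1 − ε` at `δ`-optima), matching Disproof § (b)/(c1) (`tight_two_six`, `not_linearDefectLaw_slack`). -/
theorem unitSlope_not_strengthened (η : ℝ) (hη : 0 < η) :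
    ¬ ∀ (n r : ℕ) (c : ℝ), r < algBorderRank (matMulTensor ℂ n n n) →
      (∀ S' : P n → P n → P n → ℂ, tensorRank S' ≤ r + 1 → ‖overlap S'‖ ^ 2 ≤ c * normSq S') →
      ∀ S : P n → P n → P n → ℂ, tensorRank S ≤ r → ‖overlap S‖ ^ 2 ≤ (c - 1 - η) * normSq S := by
  intro h
  obtain ⟨S, hS, hN, hEq⟩ := linearDefectLaw_tight_two_six
  have hb : 6 < algBorderRank (matMulTensor ℂ 2 2 2) := by
    rw [algBorderRank_matMulTensor_two ℂ]; norm_num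
  have hcs : ∀ S' : P 2 → P 2 → P 2 → ℂ, tensorRank S' ≤ 6 + 1 → ‖overlap S'‖ ^ 2 ≤ 8 * normSq S' := by
    intro S' _
    have h8 := overlap_sq_le S'
    norm_num at h8
    exact h8
  have key := h 2 6 8 hb hcs S hS
  simp only [overlap, normSq] at key
  rw [hEq, hN] at key
  norm_num at key
  linarith

/-- **Where the law's slack lives** (modulo S1, S2 — both provable now): below the window the slope is a
THEOREM of the line, e.g. `M(n, r+1) ≥ M(n, r) + 1` for all `n` and all `r ≤ 2n − 2`; the crux's difficulty is
confined to the window `2n − 1 ≤ r < R̲(⟨n,n,n⟩)` handled by S3. -/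
theorem slope_below_window (n r : ℕ) (hn : 2 ≤ n) (hr : r + 1 ≤ 2 * n) : SlopeAt n r :=
  slope_small oneStepGain freeUnitProductDet n r hn hr

/-- Cauchy–Schwarz at `n = 2` in the shape of a level hypothesis: `8` bounds every rank. -/
theorem eight_bounds_two (r : ℕ) :
    ∀ S' : P 2 → P 2 → P 2 → ℂ, tensorRank S' ≤ r → ‖overlap S'‖ ^ 2 ≤ 8 * normSq S' := by
  intro S' _
  have h8 := overlap_sq_le S'
  norm_num at h8
  exact h8

/-- **First window instance = the route's lead instance.** S1 and S3 at the single level `(n, r) = (2, 6)`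
(`6 < 7 = R̲(⟨2,2,2⟩)`, tree) already give `M(2,6) ≤ 7`, i.e. the body of the sibling crux `SevenEighthsLaw`
(stmt-MatrixMultiplication-4959): the constant `8` bounds rank `7` by Cauchy–Schwarz, so `8 − 1` bounds rank `6`.
Hence S3 is at least as hard as the lead instance, and a proof of S3 at `(2,6)` is a new proof route to it
(explicit-hypothesis form; nothing is claimed unconditionally). -/
theorem sevenEighths_of_window_two_six
    (h1 : ∀ (n r : ℕ) (S : P n → P n → P n → ℂ) (x y z : P n → ℂ), tensorRank S ≤ r → S ≠ 0 →
      IsUnitVec x → IsUnitVec y → IsUnitVec z →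
      ∃ S' : P n → P n → P n → ℂ, tensorRank S' ≤ r + 1 ∧
        fid S + ‖triEval (resid S) x y z‖ ^ 2 ≤ fid S')
    (h3 : ∀ (n r : ℕ), 2 * n ≤ r → r < algBorderRank (matMulTensor ℂ n n n) →
      ∀ ε : ℝ, 0 < ε → ∃ δ : ℝ, 0 < δ ∧
        ∀ S : P n → P n → P n → ℂ, tensorRank S ≤ r → S ≠ 0 →
          (∀ S' : P n → P n → P n → ℂ, tensorRank S' ≤ r → fid S' ≤ fid S + δ) →
          ∃ x y z : P n → ℂ, IsUnitVec x ∧ IsUnitVec y ∧ IsUnitVec z ∧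
            1 - ε ≤ ‖triEval (resid S) x y z‖ ^ 2) :
    ∀ S : P 2 → P 2 → P 2 → ℂ, tensorRank S ≤ 6 → ‖overlap S‖ ^ 2 ≤ 7 * normSq S := by
  intro S hS
  have hb : 6 < algBorderRank (matMulTensor ℂ 2 2 2) := by
    rw [algBorderRank_matMulTensor_two ℂ]; norm_num
  have key := slope_window h1 h3 2 6 (by norm_num) hb 8 (eight_bounds_two 7) S hS
  norm_num at key
  exact key

/-- **Second window instance = the support item `SixEighthsAtFive`** (stmt-MatrixMultiplication-14040): S1 and S3
at the two levels `(2,6)` and `(2,5)` give `M(2,5) ≤ 6` (Bini-tight on the border: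
`LinearDefectLawNeg.linearDefectLaw_tight_two_five`). -/
theorem sixEighths_of_window_two_five
    (h1 : ∀ (n r : ℕ) (S : P n → P n → P n → ℂ) (x y z : P n → ℂ), tensorRank S ≤ r → S ≠ 0 →
      IsUnitVec x → IsUnitVec y → IsUnitVec z →
      ∃ S' : P n → P n → P n → ℂ, tensorRank S' ≤ r + 1 ∧
        fid S + ‖triEval (resid S) x y z‖ ^ 2 ≤ fid S')
    (h3 : ∀ (n r : ℕ), 2 * n ≤ r → r < algBorderRank (matMulTensor ℂ n n n) →
      ∀ ε : ℝ, 0 < ε → ∃ δ : ℝ, 0 < δ ∧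
        ∀ S : P n → P n → P n → ℂ, tensorRank S ≤ r → S ≠ 0 →
          (∀ S' : P n → P n → P n → ℂ, tensorRank S' ≤ r → fid S' ≤ fid S + δ) →
          ∃ x y z : P n → ℂ, IsUnitVec x ∧ IsUnitVec y ∧ IsUnitVec z ∧
            1 - ε ≤ ‖triEval (resid S) x y z‖ ^ 2) :
    ∀ S : P 2 → P 2 → P 2 → ℂ, tensorRank S ≤ 5 → ‖overlap S‖ ^ 2 ≤ 6 * normSq S := by
  intro S hS
  have hb : 5 < algBorderRank (matMulTensor ℂ 2 2 2) := by
    rw [algBorderRank_matMulTensor_two ℂ]; norm_num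
  have h7 : ∀ S' : P 2 → P 2 → P 2 → ℂ, tensorRank S' ≤ 5 + 1 → ‖overlap S'‖ ^ 2 ≤ 7 * normSq S' :=
    fun S' hS' => sevenEighths_of_window_two_six h1 h3 S' hS'
  have key := slope_window h1 h3 2 5 (by norm_num) hb 7 h7 S hS
  norm_num at key
  exact key

/-- **Registered glue stub `stub_unitSlopeOfGains`** (raw form of `unitSlope_of_stubs`): one-step gain + free unit product (`r ≤ 2n − 1`) + spectral residual on the window (`2n ≤ r`) give the unit slope. -/
theorem stub_unitSlopeOfGains :
    (∀ (n r : ℕ) (S : Fin n × Fin n → Fin n × Fin n → Fin n × Fin n → ℂ) (x y z : Fin n × Fin n → ℂ), tensorRank S ≤ r → S ≠ 0 → (∑ i, ‖x i‖ ^ 2) = 1 → (∑ i, ‖y i‖ ^ 2) = 1 → (∑ i, ‖z i‖ ^ 2) = 1 → ∃ S' : Fin n × Fin n → Fin n × Fin n → Fin n × Fin n → ℂ, tensorRank S' ≤ r + 1 ∧ ‖∑ a, ∑ b, ∑ c, S a b c * matMulTensor ℂ n n n a b c‖ ^ 2 / (∑ a, ∑ b, ∑ c, ‖S a b c‖ ^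 2) + ‖∑ a, ∑ b, ∑ c, (matMulTensor ℂ n n n a b c - (starRingEnd ℂ) (∑ a', ∑ b', ∑ c', S a' b' c' * matMulTensor ℂ n n n a' b' c') / ((∑ a', ∑ b', ∑ c', ‖S a' b' c'‖ ^ 2 : ℝ) : ℂ) * S a b c) * x a * y b * z c‖ ^ 2 ≤ ‖∑ a, ∑ b, ∑ c, S' a b c * matMulTensor ℂ n n n a b c‖ ^ 2 / (∑ a, ∑ b, ∑ c, ‖S' a b c‖ ^ 2)) → (∀ (n r : ℕ) (S : Fin n × Fin n → Fin n × Fin n → Fin n × Fin n → ℂ), 2 ≤ n → r + 1 ≤ 2 * n → tensorRank S ≤ r → ∃ x y z : Fin n × Fin n → ℂ, (∑ i, ‖x i‖ ^ 2) = 1 ∧ (∑ i, ‖y i‖ ^ 2) = 1 ∧ (∑ i, ‖z i‖ ^ 2) = 1 ∧ (∑ a, ∑ b, ∑ c, S a b c * x a * y b * z c) = 0 ∧ (∑ a, ∑ b, ∑ c, matMulTensor ℂ n n n a b c * x a * y b * z c) = 1) → (∀ (n r : ℕ), 2 * n ≤ r → r < algBorderRank (matMulTensor ℂ n n n) → ∀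 ε : ℝ, 0 < ε → ∃ δ : ℝ, 0 < δ ∧ ∀ S : Fin n × Fin n → Fin n × Fin n → Fin n × Fin n → ℂ, tensorRank S ≤ r → S ≠ 0 → (∀ S' : Fin n × Fin n → Fin n × Fin n → Fin n × Fin n → ℂ, tensorRank S' ≤ r → ‖∑ a, ∑ b, ∑ c, S' a b c * matMulTensor ℂ n n n a b c‖ ^ 2 / (∑ a, ∑ b, ∑ c, ‖S' a b c‖ ^ 2) ≤ ‖∑ a, ∑ b, ∑ c, S a b c * matMulTensor ℂ n n n a b c‖ ^ 2 / (∑ a, ∑ b, ∑ c, ‖S a b c‖ ^ 2) + δ) → ∃ x y z : Fin n × Fin n → ℂ, (∑ i, ‖x i‖ ^ 2) = 1 ∧ (∑ i, ‖y i‖ ^ 2) = 1 ∧ (∑ i, ‖z i‖ ^ 2) = 1 ∧ 1 - ε ≤ ‖∑ a, ∑ b, ∑ c, (matMulTensor ℂ n n n a b c - (starRingEnd ℂ) (∑ a', ∑ b', ∑ c', S a' b' c' * matMulTensor ℂ n n n a' b' c') / ((∑ a', ∑ b', ∑ c', ‖S a' b' c'‖ ^ 2 : ℝ) : ℂ) *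 S a b c) * x a * y b * z c‖ ^ 2) → ∀ (n r : ℕ) (cst : ℝ), r < algBorderRank (matMulTensor ℂ n n n) → (∀ S' : Fin n × Fin n → Fin n × Fin n → Fin n × Fin n → ℂ, tensorRank S' ≤ r + 1 → ‖∑ a, ∑ b, ∑ c, S' a b c * matMulTensor ℂ n n n a b c‖ ^ 2 ≤ cst * ∑ a, ∑ b, ∑ c, ‖S' a b c‖ ^ 2) → ∀ S : Fin n × Fin n → Fin n × Fin n → Fin n × Fin n → ℂ, tensorRank S ≤ r → ‖∑ a, ∑ b, ∑ c, S a b c * matMulTensor ℂ n n n a b c‖ ^ 2 ≤ (cst - 1) * ∑ a, ∑ b, ∑ c, ‖S a b c‖ ^ 2 :=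
  fun h1 h2 h3 => unitSlope_of_stubs h1 h2 h3

end Summit.MatrixMultiplication.MatrixMultiplication.Theorems.LinearDefectLaw.Reduction

end
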